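import Summits.RiemannHypothesis.RiemannHypothesis.Theorems.Splittings.RobinFiniteLowHeightRanges
import HarnessLib

/-!
# RobinFiniteSqrtWindowBoxes — gen 16 «Q-SCALE √-WINDOW LIFTS THE LEVEL BUDGETS», part 1/5: the two-parameter prime-square tail, the `θ`-windows from Büthe 2018 alone, window-agnostic box bounds

Cell rh-split, seat rh-split-robin-finite g16 (card `cards/SPLIT-robin-finite.md` §23).

THE LEVER (gen 16).  The landed cell certificates (`RobinAnalyticSharp.cover11 … cover17`, budgets `b₁₁ … b₁₇ = 0.105 … 0.50`) price the
SECOND prime `Q` with Schoenfeld's RH-form relative error `δ(Q) = log²Q/(8π√Q)` two-sided.  Büthe 2018 Thm 2 (`Buthe2018_thm2_theta`,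
already a hypothesis of every low-height row) gives the ONE-SIDED `√`-window `y − 1.95√y ≤ θ(y) ≤ y` (`1423 ≤ y ≤ 10¹⁹`):
`δ_l(Q) = 1.95/√Q`, `δ_u = 0`, `δ(P) ↦ 0`.  Re-certifying the SAME covers (`coverOKS`, `decide +kernel`) lifts the budgets to
`b'₁₁ … b'₁₇ = 0.208, 0.332, 0.405, 0.461, 0.504, 0.538, 0.564`; Büthe 2016 and the range condition drop out below `10¹⁹`.
Rows (RH(T) in hypothesis position): `RH(10⁵) ⟹ robinCA_below 55 000 001`; `4¹³ ← RH(124 000)`, `4¹⁴ ← RH(212 000)`,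
`4¹⁵ ← RH(364 000)`, `4¹⁶ ← RH(705 000)`, `4¹⁷ ← RH(1.4·10⁶)`, `4¹⁸ ← RH(2.65·10⁶)` (tree: —, 330 000, 500 000, 860 000, 1.62·10⁶, 3·10⁶).

HONEST LABEL: SPLITTING SEARCH over kernel-typed RH-EQUIVALENCES; a splitting A ∧ B ⟹ RH is CONDITIONAL
bookkeeping unless A and B are both proved; nothing here bears on the truth of RH.

This part (1 `def`, 7 theorems): S1 `le_sum_inv_sq₂` (lower window `δ_l` on `[Q, P]`, upper `δ_u` at `Q`; the tree's `PrimeSquareTail.le_sum_inv_sq` is `δ_l = δ_u`) · S2 `thetaLower_ofB`,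
`thetaUpper_ofB`, `eight_le_log`, `thetaWindow_ofB` (two-sided Schoenfeld form on `[599, 10¹⁹]` = kernel table ∪ Büthe 2018; NO Büthe 2016 / RH(T)) ·
S3 `g2BoxA`, `G2_mul_geA`, `G1_mul_geA` (the tree's `G2_mul_ge` / `G1_mul_ge` with the window parameters `(δ_l, δ_u, δ_P)` and their rational
bounds `(d, du, dP)` free).
-/

set_option linter.dupNamespace false

noncomputable section

open Real Filter Finset
open scoped Chebyshev

namespace Summit.RiemannHypothesis.RiemannHypothesis.Theorems.Splittings.RobinFiniteC1

open Literature.NumberTheory.LFunctions Literature.NumberTheory.DiophantineGeometry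
open RobinAnalyticSharp RobinAnalyticSharp.Cells
open Summit.RiemannHypothesis.RiemannHypothesis.Theorems.Splittings.RobinFiniteE3

section SqrtWindowBoxes

/-! ### S1 · the two-parameter prime-square tail -/

/-- **Two-parameter prime-square tail.**  For reals `2 ≤ Q ≤ P`: if `θ(t) ≥ (1 − δ_l)t` on `[Q, P]` and `θ(Q) ≤ (1 + δ_u)Q`, then
`∑_{Q<p≤P} 1/p² ≥ (1 − δ_l)(log Q/(log Q + 1))(1/(Q log Q) − 1/(P log P)) − (δ_l + δ_u)/(Q log Q)`
(the tree's `PrimeSquareTail.le_sum_inv_sq` is the case `δ_l = δ_u`; same Abel-summation proof). -/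
theorem le_sum_inv_sq₂ {Q P δl δu : ℝ} (hQ : 2 ≤ Q) (hQP : Q ≤ P) (hδ1 : δl ≤ 1)
    (hθl : ∀ t ∈ Set.Icc Q P, (1 - δl) * t ≤ θ t) (hθQ : θ Q ≤ (1 + δu) * Q) :
    (1 - δl) * (Real.log Q / (Real.log Q + 1)) * (1 / (Q * Real.log Q) - 1 / (P * Real.log P))
        - (δl + δu) / (Q * Real.log Q) ≤
      ∑ p ∈ (Finset.Ioc ⌊Q⌋₊ ⌊P⌋₊).filter Nat.Prime, ((p : ℝ) ^ 2)⁻¹ := by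
  have hQ0 : (0 : ℝ) < Q := by linarith
  have hP0 : (0 : ℝ) < P := by linarith
  have hlQ : 0 < Real.log Q := Real.log_pos (by linarith)
  have hlP : 0 < Real.log P := Real.log_pos (by linarith)
  rw [PrimeSquareTail.sum_inv_sq_eq hQ hQP]
  -- (1) boundary terms
  have hbP : (1 - δl) / (P * Real.log P) ≤ θ P / (P ^ 2 * Real.log P) := by
    have h := mul_le_mul_of_nonneg_right (hθl P ⟨hQP, le_rfl⟩)
      (by positivity : (0 : ℝ) ≤ P * Real.log P)
    rw [div_le_div_iff₀ (by positivity) (by positivity)]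
    calc (1 - δl) * (P ^ 2 * Real.log P) = (1 - δl) * P * (P * Real.log P) := by ring
      _ ≤ θ P * (P * Real.log P) := h
  have hbQ : θ Q / (Q ^ 2 * Real.log Q) ≤ (1 + δu) / (Q * Real.log Q) := by
    have h := mul_le_mul_of_nonneg_right hθQ (by positivity : (0 : ℝ) ≤ Q * Real.log Q)
    rw [div_le_div_iff₀ (by positivity) (by positivity)]
    calc θ Q * (Q * Real.log Q) ≤ (1 + δu) * Q * (Q * Real.log Q) := h
      _ = (1 + δu) * (Q ^ 2 * Real.log Q) := by ring
  -- (2) the integral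
  have hmem : ∀ t ∈ Set.Icc Q P, t ∈ ({0}ᶜ : Set ℝ) := fun t ht =>
    Set.mem_compl_singleton_iff.mpr (show (0 : ℝ) < t by linarith [ht.1]).ne'
  have hlogne : ∀ t ∈ Set.Icc Q P, Real.log t ≠ 0 := fun t ht =>
    (Real.log_pos (by linarith [ht.1])).ne'
  have hw1 : ContinuousOn (fun t : ℝ ↦ (Real.log t + 1) / (t ^ 2 * Real.log t ^ 2)) (Set.Icc Q P) := by
    refine ContinuousOn.div ((Real.continuousOn_log.mono hmem).add continuousOn_const)
      ((continuousOn_pow 2).mul ((Real.continuousOn_log.mono hmem).pow 2)) fun t ht => ?_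
    have : (0 : ℝ) < t := by linarith [ht.1]
    exact mul_ne_zero (pow_ne_zero _ this.ne') (pow_ne_zero _ (hlogne t ht))
  have hw2 : ContinuousOn (fun t : ℝ ↦ (2 * Real.log t + 1) / (t ^ 3 * Real.log t ^ 2)) (Set.Icc Q P) := by
    refine ContinuousOn.div ?_ ((continuousOn_pow 3).mul ((Real.continuousOn_log.mono hmem).pow 2))
      fun t ht => ?_
    · exact (continuousOn_const.mul (Real.continuousOn_log.mono hmem)).add continuousOn_const
    · have : (0 : ℝ) < t := by linarith [ht.1]
      exact mul_ne_zero (pow_ne_zero _ this.ne') (pow_ne_zero _ (hlogne t ht))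
  set K : ℝ := (2 * Real.log Q + 1) / (Real.log Q + 1) with hK
  have hK0 : 0 ≤ K := by positivity
  have hθint : MeasureTheory.IntegrableOn (fun t ↦ θ t * ((2 * Real.log t + 1) / (t ^ 3 * Real.log t ^ 2)))
      (Set.Ioc Q P) := by
    have h := integrableOn_mul_sum_Icc (fun k => if k.Prime then Real.log k else 0) (m := 0) hQ0.le
      (hw2.integrableOn_Icc)
    refine (h.mono_set Set.Ioc_subset_Icc_self).congr_fun (fun t _ ↦ ?_) measurableSet_Ioc
    simp only [PrimeSquareTail.sum_Icc_ite_prime_log]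
    ring
  have hlow : (1 - δl) * K * (1 / (Q * Real.log Q) - 1 / (P * Real.log P)) ≤
      ∫ t in Set.Ioc Q P, θ t * ((2 * Real.log t + 1) / (t ^ 3 * Real.log t ^ 2)) := by
    rw [← PrimeSquareTail.integral_log_add_one_div hQ hQP, ← MeasureTheory.integral_const_mul]
    refine MeasureTheory.setIntegral_mono_on ((hw1.integrableOn_Icc.mono_set Set.Ioc_subset_Icc_self).const_mul _)
      hθint measurableSet_Ioc fun t ht => ?_
    have htQ : Q ≤ t := ht.1.le
    have ht0 : 0 < t := by linarith [ht.1]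
    have hlt : Real.log Q ≤ Real.log t := Real.log_le_log hQ0 htQ
    have hltpos : 0 < Real.log t := hlQ.trans_le hlt
    have hθt : (1 - δl) * t ≤ θ t := hθl t ⟨htQ, ht.2⟩
    have hKt : K * (Real.log t + 1) ≤ 2 * Real.log t + 1 := by
      rw [hK, div_mul_eq_mul_div, div_le_iff₀ (by positivity)]
      nlinarith
    have hpos : 0 ≤ (2 * Real.log t + 1) / (t ^ 3 * Real.log t ^ 2) := by positivity
    calc (1 - δl) * K * ((Real.log t + 1) / (t ^ 2 * Real.log t ^ 2))
        = (1 - δl) * t * ((K * (Real.log t + 1)) / (t ^ 3 * Real.log t ^ 2)) := by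
          field_simp
      _ ≤ (1 - δl) * t * ((2 * Real.log t + 1) / (t ^ 3 * Real.log t ^ 2)) := by
          have h1 : 0 ≤ (1 - δl) * t := by nlinarith
          exact mul_le_mul_of_nonneg_left (div_le_div_of_nonneg_right hKt (by positivity)) h1
      _ ≤ θ t * ((2 * Real.log t + 1) / (t ^ 3 * Real.log t ^ 2)) :=
          mul_le_mul_of_nonneg_right hθt hpos
  -- (3) assemble
  have hKid : (1 - δl) * (Real.log Q / (Real.log Q + 1)) * (1 / (Q * Real.log Q) - 1 / (P * Real.log P))
      - (δl + δu) / (Q * Real.log Q) =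
      (1 - δl) / (P * Real.log P) - (1 + δu) / (Q * Real.log Q) +
        (1 - δl) * K * (1 / (Q * Real.log Q) - 1 / (P * Real.log P)) := by
    rw [hK]
    field_simp
    ring
  rw [hKid]
  linarith

/-! ### S2 · the `θ`-windows from Büthe 2018 Thm 2 alone (no Büthe 2016, no RH(T)) -/

/-- Büthe 2018 Thm 2, clause 1, as a lower bound: `y − 1.95√y ≤ θ(y)` on `[1423, 10¹⁹]`. -/
theorem thetaLower_ofB (hB : Buthe2018_thm2_theta) :
    ∀ y : ℝ, 1423 ≤ y → y ≤ (10 : ℝ) ^ 19 → y - 1.95 * √y ≤ θ y := by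
  intro y hy hy'
  have := hB.1 y hy hy'
  linarith

/-- Büthe 2018 Thm 2, clause 2, as an upper bound: `θ(y) ≤ y` on `[1, 10¹⁹]`. -/
theorem thetaUpper_ofB (hB : Buthe2018_thm2_theta) :
    ∀ y : ℝ, 1 ≤ y → y ≤ (10 : ℝ) ^ 19 → θ y ≤ y := by
  intro y hy hy'
  have h := hB.2 y hy hy'
  have : 0 ≤ 0.05 * √y := by positivity
  linarith

/-- `8 ≤ log y` for `y ≥ 8886113` (`e⁸ ≤ 2981`). -/
theorem eight_le_log {y : ℝ} (hy : 8886113 ≤ y) : 8 ≤ Real.log y := by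
  have hy0 : 0 < y := by linarith
  rw [Real.le_log_iff_exp_le hy0]
  calc Real.exp 8 = Real.exp 1 ^ 8 := by rw [← Real.exp_nat_mul]; norm_num
    _ ≤ 2.7182818286 ^ 8 := by
        exact pow_le_pow_left₀ (Real.exp_pos 1).le Real.exp_one_lt_d9.le 8
    _ ≤ y := le_trans (by norm_num) hy

/-- **The two-sided Schoenfeld-form window on `[599, 10¹⁹]` from Büthe 2018 alone**: the kernel table `ThetaSmallRange` on
`[599, 8886113]`, and above it `|θ y − y| = y − θ y ≤ 1.95√y ≤ √y log² y/(8π)` (`log y ≥ 8`).  The tree's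
`thetaWindow_low` needs Büthe 2016 Thm 2 + RH(T) + Büthe's range condition for the part above the table. -/
theorem thetaWindow_ofB (hB : Buthe2018_thm2_theta) :
    ∀ y : ℝ, 599 ≤ y → y ≤ (10 : ℝ) ^ 19 → |θ y - y| ≤ √y * Real.log y ^ 2 / (8 * π) := by
  intro y hy hyB
  by_cases hs : y ≤ 8886113
  · exact abs_theta_sub_le_smallRange hy hs
  · rw [not_le] at hs
    have hπ := Real.pi_lt_d6
    have hlo := thetaLower_ofB hB y (by linarith) hyB
    have hup := thetaUpper_ofB hB y (by linarith) hyB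
    have h8 := eight_le_log hs.le
    have hs0 : 0 ≤ √y := Real.sqrt_nonneg _
    rw [abs_sub_comm, abs_of_nonneg (by linarith)]
    have h64 : (64 : ℝ) ≤ Real.log y ^ 2 := by nlinarith
    calc y - θ y ≤ 1.95 * √y := by linarith
      _ ≤ √y * Real.log y ^ 2 / (8 * π) := by
          rw [le_div_iff₀ (by positivity)]
          nlinarith [mul_nonneg hs0 (by linarith : (0 : ℝ) ≤ Real.log y ^ 2 - 64)]

/-! ### S3 · window-agnostic box bounds for `G₂` and `G₁`

The tree's `G2_mul_ge(W)` / `G1_mul_ge(W)` (`RobinAnalyticSharp`, `RobinFiniteE3Window`) hard-wire the two-sided Schoenfeld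
window.  Here the `θ`-facts at the point of use are HYPOTHESES: a relative lower error `δ_l` on `[Q, P]`, an upper error `δ_u` at
`Q`, an upper error `δ_P` at `P`, with certified rational majorants `d, du, dP`. -/

/-- The window-agnostic `G₂` box: `((1 − d)(ℓ₁/(ℓ₁ + 1)) − (d + du))·mlow − 1/s₁` (the tree's `g2Box d₁ ℓ₁ mlow s₁` is `du = d`). -/
def g2BoxA (d du ℓ₁ mlow s₁ : ℝ) : ℝ := ((1 - d) * (ℓ₁ / (ℓ₁ + 1)) - (d + du)) * mlow - 1 / s₁

/-- **Window-agnostic box bound for `G₂ = ∑_{Q<p≤P} 1/p²`**: from the two-parameter tail bound at `(Q, P)` and the cell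
enclosures, `G₂·√P·log P ≥ g2BoxA d du ℓ₁ mlow s₁` (proof of `RobinAnalyticSharp.G2_mul_ge` with `2δ ↦ δ_l + δ_u`). -/
theorem G2_mul_geA {P Q : ℕ} {a₂ δl δu d du ℓ₁ L₁ s₁ mlow : ℝ}
    (hQ : 599 ≤ Q) (hQP : Q ≤ P)
    (hG : (1 - δl) * (Real.log Q / (Real.log Q + 1)) *
          (1 / ((Q : ℝ) * Real.log Q) - 1 / ((P : ℝ) * Real.log P)) - (δl + δu) / ((Q : ℝ) * Real.log Q) ≤
        ∑ p ∈ (Nat.primesLE P).filter (fun p => Q < p), ((p : ℝ) ^ 2)⁻¹)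
    (hδl : δl ≤ d) (hδl0 : 0 ≤ δl) (hδu : δu ≤ du) (hd1 : d ≤ 1 / 2)
    (ha₂ : (Q : ℝ) ≤ a₂ * √(P : ℝ)) (ha₂0 : 0 < a₂)
    (hℓ₁ : ℓ₁ ≤ Real.log Q) (hℓ₁0 : 0 < ℓ₁)
    (hL₁ : L₁ ≤ Real.log P) (hs₁ : s₁ ≤ √(P : ℝ)) (hs₁0 : 0 < s₁)
    (hm0 : 0 ≤ mlow) (hm : ∀ L : ℝ, L₁ ≤ L → mlow * (a₂ * (Real.log a₂ + L / 2)) ≤ L)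
    (hκ : 0 ≤ (1 - d) * (ℓ₁ / (ℓ₁ + 1)) - (d + du)) :
    g2BoxA d du ℓ₁ mlow s₁ ≤
      (∑ p ∈ (Nat.primesLE P).filter (fun p => Q < p), ((p : ℝ) ^ 2)⁻¹) * (√(P : ℝ) * Real.log P) := by
  have hQr : (599 : ℝ) ≤ Q := by exact_mod_cast hQ
  have hQPr : (Q : ℝ) ≤ P := by exact_mod_cast hQP
  have hP0 : (0 : ℝ) < P := by linarith
  have hQ0 : (0 : ℝ) < Q := by linarith
  set L := Real.log (P : ℝ) with hL
  set s := √(P : ℝ) with hs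
  set ℓ := Real.log (Q : ℝ) with hℓ
  have hs0 : 0 < s := Real.sqrt_pos.2 hP0
  have hss : s * s = P := Real.mul_self_sqrt hP0.le
  have hlogs : Real.log s = L / 2 := by rw [hs, Real.log_sqrt hP0.le]
  have hℓpos : 0 < ℓ := Real.log_pos (by linarith)
  have hLpos : 0 < L := Real.log_pos (by linarith)
  set S := ∑ p ∈ (Nat.primesLE P).filter (fun p => Q < p), ((p : ℝ) ^ 2)⁻¹ with hSdef
  -- `m = sL/(Qℓ) ≥ mlow`
  set m := s * L / ((Q : ℝ) * ℓ) with hmdef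
  have hm_ge : mlow ≤ m := by
    have h1 : ℓ ≤ Real.log a₂ + L / 2 := by
      have : ℓ ≤ Real.log (a₂ * s) := Real.log_le_log hQ0 ha₂
      rwa [Real.log_mul ha₂0.ne' hs0.ne', hlogs] at this
    have hden : 0 < Real.log a₂ + L / 2 := hℓpos.trans_le h1
    have h2 := hm L hL₁
    have h3 : mlow ≤ L / (a₂ * (Real.log a₂ + L / 2)) := by
      rw [le_div_iff₀ (by positivity)]; exact h2
    have h4 : L / (a₂ * (Real.log a₂ + L / 2)) ≤ L / (a₂ * ℓ) :=
      div_le_div_of_nonneg_left hLpos.le (by positivity) (mul_le_mul_of_nonneg_left h1 ha₂0.le)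
    have h5 : L / (a₂ * ℓ) ≤ m := by
      rw [hmdef, div_le_div_iff₀ (by positivity) (by positivity)]
      have h6 := mul_le_mul_of_nonneg_right ha₂ (by positivity : (0 : ℝ) ≤ L * ℓ)
      calc L * ((Q : ℝ) * ℓ) = (Q : ℝ) * (L * ℓ) := by ring
        _ ≤ a₂ * s * (L * ℓ) := h6
        _ = s * L * (a₂ * ℓ) := by ring
    linarith
  -- multiply the tail bound by `sL`
  have hmain : ((1 - δl) * (ℓ / (ℓ + 1)) - (δl + δu)) * m - (1 - δl) * (ℓ / (ℓ + 1)) / s ≤ S * (s * L) := by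
    have e : ((1 - δl) * (ℓ / (ℓ + 1)) * (1 / ((Q : ℝ) * ℓ) - 1 / ((P : ℝ) * L)) - (δl + δu) / ((Q : ℝ) * ℓ))
        * (s * L) = ((1 - δl) * (ℓ / (ℓ + 1)) - (δl + δu)) * m - (1 - δl) * (ℓ / (ℓ + 1)) / s := by
      rw [hmdef, ← hss]
      field_simp
      ring
    rw [← e]
    exact mul_le_mul_of_nonneg_right hG (by positivity)
  -- compare with the box
  have hfrac : ℓ₁ / (ℓ₁ + 1) ≤ ℓ / (ℓ + 1) := by
    rw [div_le_div_iff₀ (by positivity) (by positivity)]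
    nlinarith
  have hfrac1 : ℓ / (ℓ + 1) ≤ 1 := by rw [div_le_one (by positivity)]; linarith
  have hfrac0 : 0 ≤ ℓ / (ℓ + 1) := by positivity
  have hbr : (1 - d) * (ℓ₁ / (ℓ₁ + 1)) - (d + du) ≤ (1 - δl) * (ℓ / (ℓ + 1)) - (δl + δu) := by
    have h1 : (1 - d) * (ℓ₁ / (ℓ₁ + 1)) ≤ (1 - δl) * (ℓ / (ℓ + 1)) :=
      mul_le_mul (by linarith) hfrac (by positivity) (by linarith)
    linarith
  have hterm1 : ((1 - d) * (ℓ₁ / (ℓ₁ + 1)) - (d + du)) * mlow ≤ ((1 - δl) * (ℓ / (ℓ + 1)) - (δl + δu)) * m :=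
    mul_le_mul hbr hm_ge hm0 (hκ.trans hbr)
  have hterm2 : (1 - δl) * (ℓ / (ℓ + 1)) / s ≤ 1 / s₁ := by
    have h1 : (1 - δl) * (ℓ / (ℓ + 1)) ≤ 1 := by
      calc (1 - δl) * (ℓ / (ℓ + 1)) ≤ 1 * (ℓ / (ℓ + 1)) :=
            mul_le_mul_of_nonneg_right (by linarith) hfrac0
        _ ≤ 1 := by linarith
    calc (1 - δl) * (ℓ / (ℓ + 1)) / s ≤ 1 / s := div_le_div_of_nonneg_right h1 hs0.le
      _ ≤ 1 / s₁ := div_le_div_of_nonneg_left zero_le_one hs₁0 hs₁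
  unfold g2BoxA
  linarith

/-- **Window-agnostic box bound for `G₁ = θQ/((θP + θQ) log(θP + θQ))`**: with `θ(Q) ≥ (1 − δ_l)Q`, `θ(Q) ≤ (1 + δ_u)Q`,
`1 ≤ θ(P) ≤ (1 + δ_P)P` and majorants `d, du, dP`, `G₁·√P·log P ≥ g1Box d a₁ cR L₁` for any `cR ≥ (1 + dP) + (1 + du)a₂/s₁`
(proof of `RobinAnalyticSharp.G1_mul_ge` with the `θ`-facts as hypotheses). -/
theorem G1_mul_geA {P Q : ℕ} {a₁ a₂ δl δu δP d du dP L₁ s₁ cR : ℝ}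
    (hQ : 599 ≤ Q) (hQP : Q ≤ P)
    (hθQl : (1 - δl) * (Q : ℝ) ≤ θ Q) (hθQu : θ Q ≤ (1 + δu) * (Q : ℝ))
    (hθP1 : 1 ≤ θ P) (hθPu : θ P ≤ (1 + δP) * (P : ℝ))
    (hδl : δl ≤ d) (hδl0 : 0 ≤ δl) (hd1 : d ≤ 1 / 2) (hδu : δu ≤ du) (hδu0 : 0 ≤ δu)
    (hδP : δP ≤ dP) (hδP0 : 0 ≤ δP)
    (ha₁ : a₁ * √(P : ℝ) ≤ Q) (ha₂ : (Q : ℝ) ≤ a₂ * √(P : ℝ)) (ha₁0 : 0 ≤ a₁) (ha₂0 : 0 < a₂)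
    (hL₁ : L₁ ≤ Real.log P) (hL₁0 : 0 < L₁) (hs₁ : s₁ ≤ √(P : ℝ)) (hs₁0 : 0 < s₁)
    (hcR : (1 + dP) + (1 + du) * a₂ / s₁ ≤ cR) :
    g1Box d a₁ cR L₁ ≤
      θ Q / ((θ P + θ Q) * Real.log (θ P + θ Q)) * (√(P : ℝ) * Real.log P) := by
  have hQr : (599 : ℝ) ≤ Q := by exact_mod_cast hQ
  have hQPr : (Q : ℝ) ≤ P := by exact_mod_cast hQP
  have hP0 : (0 : ℝ) < P := by linarith
  have hQ0 : (0 : ℝ) < Q := by linarith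
  set L := Real.log (P : ℝ) with hL
  set s := √(P : ℝ) with hs
  have hs0 : 0 < s := Real.sqrt_pos.2 hP0
  have hss : s * s = P := Real.mul_self_sqrt hP0.le
  have hLpos : 0 < L := Real.log_pos (by linarith)
  have hd0 : 0 ≤ d := hδl0.trans hδl
  have hdu0 : 0 ≤ du := hδu0.trans hδu
  have hdP0 : 0 ≤ dP := hδP0.trans hδP
  -- `G₁ ≥ (1−δl) Q/(R₁ log R₁)` with `R₁ = (1+δP)P + (1+δu)Q`
  set R₁ := (1 + δP) * P + (1 + δu) * Q with hR₁
  have hlow : 0 ≤ (1 - δl) * Q := mul_nonneg (by linarith) hQ0.le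
  have hG := G1_lower hθP1 (Chebyshev.theta_nonneg _) hθQl hlow (by linarith : θ P + θ Q ≤ R₁)
  -- `R₁ ≤ cR P`, `log R₁ ≤ L + (cR − 1)`
  have hcR1 : 1 ≤ cR := by
    have : 0 ≤ (1 + du) * a₂ / s₁ := by positivity
    linarith
  have hR₁le : R₁ ≤ cR * P := by
    have h1 : (1 + δu) * (Q : ℝ) ≤ (1 + du) * (a₂ * s) :=
      mul_le_mul (by linarith) ha₂ hQ0.le (by linarith)
    have h2 : (1 + du) * (a₂ * s) = ((1 + du) * a₂ / s) * P := by
      rw [← hss]; field_simp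
    have h3 : (1 + du) * a₂ / s ≤ (1 + du) * a₂ / s₁ :=
      div_le_div_of_nonneg_left (mul_nonneg (by linarith) ha₂0.le) hs₁0 hs₁
    have h4 : (1 + δP) * (P : ℝ) ≤ (1 + dP) * P := mul_le_mul_of_nonneg_right (by linarith) hP0.le
    calc R₁ = (1 + δP) * P + (1 + δu) * Q := rfl
      _ ≤ (1 + dP) * P + ((1 + du) * a₂ / s) * P := by rw [← h2]; linarith
      _ ≤ (1 + dP) * P + ((1 + du) * a₂ / s₁) * P := by
          have := mul_le_mul_of_nonneg_right h3 hP0.le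
          linarith
      _ = ((1 + dP) + (1 + du) * a₂ / s₁) * P := by ring
      _ ≤ cR * P := mul_le_mul_of_nonneg_right hcR hP0.le
  have hPδ : (P : ℝ) ≤ (1 + δP) * P := by
    have := mul_nonneg hδP0 hP0.le
    linarith [show (1 + δP) * (P : ℝ) = P + δP * P by ring]
  have hQδ : 0 ≤ (1 + δu) * (Q : ℝ) := by positivity
  have hR₁1 : 1 < R₁ := by simp only [hR₁]; linarith
  have hlogR : R₁ * Real.log R₁ ≤ (cR * P) * (L + (cR - 1)) := by
    have h1 := mul_log_mono hR₁1.le hR₁le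
    have h2 : Real.log (cR * P) ≤ L + (cR - 1) := by
      rw [Real.log_mul (by positivity) hP0.ne']
      linarith [Real.log_le_sub_one_of_pos (by positivity : 0 < cR)]
    exact h1.trans (mul_le_mul_of_nonneg_left h2 (by positivity))
  have hden0 : 0 < R₁ * Real.log R₁ := mul_pos (by linarith) (Real.log_pos hR₁1)
  have hnum : (1 - d) * (a₁ * s) ≤ (1 - δl) * Q := mul_le_mul (by linarith) ha₁ (by positivity) (by linarith)
  have hG2 : (1 - d) * (a₁ * s) / ((cR * P) * (L + (cR - 1))) ≤ (1 - δl) * Q / (R₁ * Real.log R₁) := by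
    calc (1 - d) * (a₁ * s) / ((cR * P) * (L + (cR - 1)))
        ≤ (1 - d) * (a₁ * s) / (R₁ * Real.log R₁) :=
          div_le_div_of_nonneg_left (mul_nonneg (by linarith) (by positivity)) hden0 hlogR
      _ ≤ (1 - δl) * Q / (R₁ * Real.log R₁) := div_le_div_of_nonneg_right hnum hden0.le
  have e : (1 - d) * (a₁ * s) / ((cR * P) * (L + (cR - 1))) * (s * L) =
      (1 - d) * a₁ / (cR * (1 + (cR - 1) / L)) := by
    rw [← hss]; field_simp
  have hbox : g1Box d a₁ cR L₁ ≤ (1 - d) * a₁ / (cR * (1 + (cR - 1) / L)) := by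
    unfold g1Box
    apply div_le_div_of_nonneg_left (mul_nonneg (by linarith) ha₁0) (by
      have : 0 ≤ (cR - 1) / L := by apply div_nonneg <;> linarith
      positivity)
    apply mul_le_mul_of_nonneg_left _ (by linarith)
    have : (cR - 1) / L ≤ (cR - 1) / L₁ := div_le_div_of_nonneg_left (by linarith) hL₁0 hL₁
    linarith
  calc g1Box d a₁ cR L₁ ≤ (1 - d) * a₁ / (cR * (1 + (cR - 1) / L)) := hbox
    _ = (1 - d) * (a₁ * s) / ((cR * P) * (L + (cR - 1))) * (s * L) := e.symm
    _ ≤ (1 - δl) * Q / (R₁ * Real.log R₁) * (s * L) :=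
        mul_le_mul_of_nonneg_right hG2 (by positivity)
    _ ≤ θ Q / ((θ P + θ Q) * Real.log (θ P + θ Q)) * (s * L) :=
        mul_le_mul_of_nonneg_right hG (by positivity)

end SqrtWindowBoxes

end Summit.RiemannHypothesis.RiemannHypothesis.Theorems.Splittings.RobinFiniteC1

end
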